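import Literature.Analysis.FunctionSpaces.TorusCubeFieldTransfer
import Literature.Analysis.FunctionSpaces.TorusCalculusProofs
import Literature.Analysis.FluidPDE.StationaryEulerWavePackets
import Literature.Analysis.FluidPDE.StationaryEulerAlignedCubes
import HarnessLib

/-!
# Wave packets on the flat torus: periodisation and the weak subsolution identities
(Choffrut–Székelyhidi 2014, Lemma 2 / §2 Step 3)

Topic `Literature/Analysis/FluidPDE`. Support file of the proof of
`Literature.Analysis.FluidPDE.Torus.ChoffrutSzekelyhidi2014_thm1` (Choffrut–Székelyhidi, SIAM
J. Math. Anal. 46 (2014) = arXiv:1401.4301). The perturbations of the convex-integration scheme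
are wave packets (`StationaryEulerWavePackets.lean`) supported in the open unit cube, read on
`T^d` through the periodisation `Torus.periodize` of the tree (`TorusPeriodizationCube`):

* scalar decomposition of a packet's field on `ℝ^d`: velocity components `velC`, symmetric
  divergence-free part `strSC`, pressure `prC`, with `str = strSC - prC δ`, `div velC = 0`,
  `div strSC = 0` pointwise (sums of the laws of Lemma 3 over the terms);
* `tfield P = periodize P.field`: smooth on `T^d`, equal to `P.field ∘ repr`, partial
  derivatives `∂ⱼ = pd eⱼ` read at `repr`, `∫_{T^d} tfield = ∫_{ℝ^d} field = 0`,
  `∫ ‖tfield‖² = ∫ ‖field‖²`;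
* **the weak stationary subsolution identities without pressure** (`IsTorusSub`): for every
  smooth `θ`, `∫ Σᵢ vᵢ ∂ᵢθ = 0`, and for every smooth divergence-free `Φ`,
  `∫ Σᵢⱼ uᵢⱼ ∂ⱼΦᵢ = 0` — the two identities that pass to `L¹`-limits and, together with
  `u = v ⊗ v - (e/d) Id` a.e., give the weak Euler equations (Lemma 2 of the paper); proved for
  periodised packets by integration by parts on `T^d` (`TorusCalculusProofs`).

## References

* A. Choffrut, L. Székelyhidi Jr., SIAM J. Math. Anal. 46 (2014), §2 (Lemma 2, Step 3).
-/

noncomputable section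

open scoped InnerProductSpace ContDiff
open Set Function MeasureTheory
open Literature.Analysis.FunctionSpaces

namespace Literature.Analysis.FluidPDE

namespace StationaryEuler

variable {d : Type*} [Fintype d] [DecidableEq d]

/-! ## Scalar decomposition of a packet -/

namespace Packet

/-- Velocity components of a packet's field. [folklore] -/
def velC (P : Packet d) (i : d) (x : Ed d) : ℝ := (P.map fun τ => τ.cert.velPot τ.φ i x).sum

/-- Symmetric divergence-free stress part `S = Σ_τ S_τ`. [folklore] -/
def strSC (P : Packet d) (i j : d) (x : Ed d) : ℝ := (P.map fun τ => τ.cert.strS τ.φ i j x).sum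

/-- The pressure `q = Σ_τ tr S_τ / d`. [folklore] -/
def prC (P : Packet d) (x : Ed d) : ℝ := (P.map fun τ => (∑ m, τ.cert.strS τ.φ m m x) / (Fintype.card d : ℝ)).sum

/-- `velC` of the empty packet. [folklore] -/
@[simp] theorem velC_nil (i : d) (x : Ed d) : velC ([] : Packet d) i x = 0 := rfl
/-- `velC` of a cons. [folklore] -/
@[simp] theorem velC_cons (τ : WaveTerm d) (P : Packet d) (i : d) (x : Ed d) :
    velC (τ :: P) i x = τ.cert.velPot τ.φ i x + velC P i x := rfl
/-- `strSC` of the empty packet. [folklore] -/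
@[simp] theorem strSC_nil (i j : d) (x : Ed d) : strSC ([] : Packet d) i j x = 0 := rfl
/-- `strSC` of a cons. [folklore] -/
@[simp] theorem strSC_cons (τ : WaveTerm d) (P : Packet d) (i j : d) (x : Ed d) :
    strSC (τ :: P) i j x = τ.cert.strS τ.φ i j x + strSC P i j x := rfl
/-- `prC` of the empty packet. [folklore] -/
@[simp] theorem prC_nil (x : Ed d) : prC ([] : Packet d) x = 0 := rfl
/-- `prC` of a cons. [folklore] -/
@[simp] theorem prC_cons (τ : WaveTerm d) (P : Packet d) (x : Ed d) :
    prC (τ :: P) x = (∑ m, τ.cert.strS τ.φ m m x) / (Fintype.card d : ℝ) + prC P x := rfl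

/-- Velocity coordinates of the field. [folklore] -/
theorem vel_field_apply (P : Packet d) (x : Ed d) (i : d) : vel (field P x) i = velC P i x := by
  induction P with
  | nil => simp
  | cons τ P ih => rw [field_cons, vel_add, PiLp.add_apply, ih, velC_cons]; rfl

/-- Stress coordinates of the field: `u = S - q δ`. [folklore] -/
theorem str_field_apply (P : Packet d) (x : Ed d) (i j : d) :
    str (field P x) i j = strSC P i j x - if i = j then prC P x else 0 := by
  induction P with
  | nil => simp
  | cons τ P ih =>
    rw [field_cons, str_add, Matrix.add_apply, ih, strSC_cons, prC_cons, WaveTerm.field, WaveCert.str_field,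
      WaveCert.strPot]
    split_ifs <;> ring

/-- The velocity components are smooth. [folklore] -/
theorem contDiff_velC (P : Packet d) (i : d) : ContDiff ℝ ∞ (velC P i) := by
  induction P with
  | nil => exact contDiff_const
  | cons τ P ih =>
    show ContDiff ℝ ∞ fun x => τ.cert.velPot τ.φ i x + velC P i x
    exact (τ.cert.contDiff_velPot τ.smooth i).add ih

/-- The stress parts are smooth. [folklore] -/
theorem contDiff_strSC (P : Packet d) (i j : d) : ContDiff ℝ ∞ (strSC P i j) := by
  induction P with
  | nil => exact contDiff_const
  | cons τ P ih =>
    show ContDiff ℝ ∞ fun x => τ.cert.strS τ.φ i j x + strSC P i j x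
    exact (τ.cert.contDiff_strS τ.smooth i j).add ih

/-- The pressure is smooth. [folklore] -/
theorem contDiff_prC (P : Packet d) : ContDiff ℝ ∞ (prC P) := by
  induction P with
  | nil => exact contDiff_const
  | cons τ P ih =>
    show ContDiff ℝ ∞ fun x => (∑ m, τ.cert.strS τ.φ m m x) / (Fintype.card d : ℝ) + prC P x
    exact ((ContDiff.sum fun m _ => τ.cert.contDiff_strS τ.smooth m m).div_const _).add ih

/-- **`div v = 0`** for the packet. [cite: ChoffrutSzekelyhidi2014, Lemma 3] -/
theorem div_velC (P : Packet d) (x : Ed d) : ∑ i, pd (eb i) (velC P i) x = 0 := by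
  induction P with
  | nil => simp [show (velC ([] : Packet d)) = fun _ _ => 0 from rfl, pd_const]
  | cons τ P ih =>
    have h : ∀ i, pd (eb i) (velC (τ :: P) i) =
        fun x => pd (eb i) (τ.cert.velPot τ.φ i) x + pd (eb i) (velC P i) x := by
      intro i
      show pd (eb i) (fun x => τ.cert.velPot τ.φ i x + velC P i x) = _
      exact pd_add (differentiable_of_smooth (τ.cert.contDiff_velPot τ.smooth i))
        (differentiable_of_smooth (contDiff_velC P i)) _
    simp only [h, Finset.sum_add_distrib, ih, τ.cert.div_velPot τ.smooth, add_zero]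

/-- **`div S = 0`** row-wise for the packet. [cite: ChoffrutSzekelyhidi2014, Lemma 3] -/
theorem div_strSC (P : Packet d) (i : d) (x : Ed d) : ∑ j, pd (eb j) (strSC P i j) x = 0 := by
  induction P with
  | nil => simp [show (strSC ([] : Packet d)) = fun _ _ _ => 0 from rfl, pd_const]
  | cons τ P ih =>
    have h : ∀ j, pd (eb j) (strSC (τ :: P) i j) =
        fun x => pd (eb j) (τ.cert.strS τ.φ i j) x + pd (eb j) (strSC P i j) x := by
      intro j
      show pd (eb j) (fun x => τ.cert.strS τ.φ i j x + strSC P i j x) = _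
      exact pd_add (differentiable_of_smooth (τ.cert.contDiff_strS τ.smooth i j))
        (differentiable_of_smooth (contDiff_strSC P i j)) _
    simp only [h, Finset.sum_add_distrib, ih, τ.cert.div_strS τ.smooth, add_zero]

/-- A packet supported in `B` has all velocity parts vanishing off `B`. [folklore] -/
theorem velC_eq_zero {B : Set (Ed d)} {P : Packet d} (hP : SuppIn B P) {x : Ed d} (hx : x ∉ B) (i : d) :
    velC P i x = 0 := by
  induction P with
  | nil => rfl
  | cons τ P ih =>
    have hτ : x ∉ tsupport τ.φ := fun h => hx (hP τ List.mem_cons_self h)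
    rw [velC_cons, ih fun τ' hτ' => hP τ' (List.mem_cons_of_mem _ hτ'), add_zero]
    simp [WaveCert.velPot, WaveCert.pd_pd_eq_zero_of_notMem hτ]

/-- A packet supported in `B` has stress parts vanishing off `B`. [folklore] -/
theorem strSC_eq_zero {B : Set (Ed d)} {P : Packet d} (hP : SuppIn B P) {x : Ed d} (hx : x ∉ B) (i j : d) :
    strSC P i j x = 0 := by
  induction P with
  | nil => rfl
  | cons τ P ih =>
    have hτ : x ∉ tsupport τ.φ := fun h => hx (hP τ List.mem_cons_self h)
    rw [strSC_cons, ih fun τ' hτ' => hP τ' (List.mem_cons_of_mem _ hτ'), add_zero]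
    simp [WaveCert.strS, WaveCert.pd_pd_eq_zero_of_notMem hτ]

/-- A packet supported in `B` has pressure vanishing off `B`. [folklore] -/
theorem prC_eq_zero {B : Set (Ed d)} {P : Packet d} (hP : SuppIn B P) {x : Ed d} (hx : x ∉ B) : prC P x = 0 := by
  induction P with
  | nil => rfl
  | cons τ P ih =>
    have hτ : x ∉ tsupport τ.φ := fun h => hx (hP τ List.mem_cons_self h)
    rw [prC_cons, ih fun τ' hτ' => hP τ' (List.mem_cons_of_mem _ hτ'), add_zero]
    simp [WaveCert.strS, WaveCert.pd_pd_eq_zero_of_notMem hτ]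

end Packet

/-! ## Smooth functions supported in the open unit cube, read on the torus -/

section Periodize

variable {F : Type*} [NormedAddCommGroup F] [NormedSpace ℝ F]

omit [Fintype d] [DecidableEq d] in
/-- The open box of the aligned-cube file is the open unit cube of the periodisation files. [folklore] -/
theorem box_eq_openCube : box d = {y : Ed d | ∀ i, y i ∈ Ioo (0 : ℝ) 1} := rfl

/-- The periodisation of a smooth function supported in the open unit cube is smooth. [folklore] -/
theorem isSmooth_periodize_of_box {g : Ed d → F} (hg : ContDiff ℝ ∞ g) (hgs : tsupport g ⊆ box d) :
    Torus.IsSmooth (Torus.periodize g) :=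
  Torus.isSmooth_periodize hg (Torus.tsupport_subset_closedBall_of_openCube hgs)

omit [Fintype d] [DecidableEq d] [NormedSpace ℝ F] in
/-- A function with support in the open unit cube vanishes off it. [folklore] -/
theorem eq_zero_off_box {g : Ed d → F} (hgs : tsupport g ⊆ box d) :
    ∀ y, (¬ ∀ i, y i ∈ Ioo (0 : ℝ) 1) → g y = 0 :=
  Torus.eq_zero_of_tsupport_subset_openCube hgs

omit [NormedSpace ℝ F] in
/-- Values of the periodisation: `periodize g x = g (repr x)`. [folklore] -/
theorem periodize_eq_repr {g : Ed d → F} (hgs : tsupport g ⊆ box d) (x : UnitAddTorus d) :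
    Torus.periodize g x = g (Torus.repr x) :=
  Torus.periodize_eq_apply_repr (eq_zero_off_box hgs) x

/-- **Partial derivatives of the periodisation**: `∂ⱼ(periodize g)(x) = ∂ⱼ g (repr x)`. [folklore] -/
theorem partialDeriv_periodize_of_box {g : Ed d → F} (hg : ContDiff ℝ ∞ g) (hgs : tsupport g ⊆ box d)
    (j : d) (x : UnitAddTorus d) :
    Torus.partialDeriv j (Torus.periodize g) x = fderiv ℝ g (Torus.repr x) (eb j) := by
  have hR := Torus.tsupport_subset_closedBall_of_openCube hgs
  rw [Torus.partialDeriv_eq_fderiv_apply ((isSmooth_periodize_of_box hg hgs).isContDiff (by simp)),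
    Torus.fderiv_periodize' (hg.of_le (by simp)) hR]
  have h0 : ∀ y, (¬ ∀ i, y i ∈ Ioo (0 : ℝ) 1) → fderiv ℝ g y = 0 := fun y hy =>
    image_eq_zero_of_notMem_tsupport fun h => hy (hgs (tsupport_fderiv_subset ℝ h))
  rw [Torus.perSum_eq_self_of_mem_unitCube h0 (Torus.repr_mem_unitCube x)]

/-- Integral of the periodisation: `∫_{T^d} periodize g = ∫_{ℝ^d} g`. [folklore] -/
theorem integral_periodize_of_box {g : Ed d → F} (hg : Continuous g) (hgs : tsupport g ⊆ box d) :
    ∫ x, Torus.periodize g x = ∫ y, g y :=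
  Torus.integral_periodize_of_cube hg (isClosed_tsupport g) hgs fun _ hy => image_eq_zero_of_notMem_tsupport hy

end Periodize

omit [DecidableEq d] in
/-- Products of smooth real functions on the torus are smooth. [folklore] -/
theorem isSmooth_mul' {f g : UnitAddTorus d → ℝ} (hf : Torus.IsSmooth f) (hg : Torus.IsSmooth g) :
    Torus.IsSmooth (fun y => f y * g y) :=
  ContDiff.mul hf hg

/-! ## Packets read on the torus -/

namespace Packet

/-- Support of the field of a packet supported in the open box. [folklore] -/
theorem tsupport_field_subset_box {P : Packet d} (hP : SuppIn (box d) P) : tsupport (field P) ⊆ box d := by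
  suffices h : tsupport (field P) ⊆ ⋃ τ ∈ P, tsupport τ.φ from h.trans (iUnion₂_subset hP)
  have hcl : IsClosed (⋃ τ ∈ P, tsupport τ.φ) := (Set.Finite.isClosed_biUnion P.finite_toSet fun τ _ => isClosed_tsupport _)
  refine closure_minimal (fun x hx => ?_) hcl
  by_contra h
  simp only [mem_iUnion, exists_prop, not_exists, not_and] at h
  exact hx (field_eq_zero_of_forall h)

/-- The velocity parts are supported in the box. [folklore] -/
theorem tsupport_velC_subset {P : Packet d} (hP : SuppIn (box d) P) (i : d) : tsupport (Packet.velC P i) ⊆ box d := by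
  refine (closure_minimal (fun x hx => ?_) (Set.Finite.isClosed_biUnion P.finite_toSet
    fun τ _ => isClosed_tsupport _)).trans (iUnion₂_subset hP)
  by_contra hc
  simp only [mem_iUnion, exists_prop, not_exists, not_and] at hc
  exact hx (velC_eq_zero (B := ⋃ τ ∈ P, tsupport τ.φ) (fun τ hτ => subset_iUnion₂ (s := fun τ _ => tsupport τ.φ) τ hτ)
    (by simpa using hc) i)

/-- The stress parts are supported in the box. [folklore] -/
theorem tsupport_strSC_subset {P : Packet d} (hP : SuppIn (box d) P) (i j : d) : tsupport (Packet.strSC P i j) ⊆ box d := by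
  refine (closure_minimal (fun x hx => ?_) (Set.Finite.isClosed_biUnion P.finite_toSet
    fun τ _ => isClosed_tsupport _)).trans (iUnion₂_subset hP)
  by_contra hc
  simp only [mem_iUnion, exists_prop, not_exists, not_and] at hc
  exact hx (strSC_eq_zero (B := ⋃ τ ∈ P, tsupport τ.φ) (fun τ hτ => subset_iUnion₂ (s := fun τ _ => tsupport τ.φ) τ hτ)
    (by simpa using hc) i j)

/-- The pressure is supported in the box. [folklore] -/
theorem tsupport_prC_subset {P : Packet d} (hP : SuppIn (box d) P) : tsupport (Packet.prC P) ⊆ box d := by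
  refine (closure_minimal (fun x hx => ?_) (Set.Finite.isClosed_biUnion P.finite_toSet
    fun τ _ => isClosed_tsupport _)).trans (iUnion₂_subset hP)
  by_contra hc
  simp only [mem_iUnion, exists_prop, not_exists, not_and] at hc
  exact hx (prC_eq_zero (B := ⋃ τ ∈ P, tsupport τ.φ) (fun τ hτ => subset_iUnion₂ (s := fun τ _ => tsupport τ.φ) τ hτ)
    (by simpa using hc))

/-- **The torus field of a packet**: the periodisation of its field. [cite: ChoffrutSzekelyhidi2014, §2, Step 3] -/
abbrev tfield (P : Packet d) : UnitAddTorus d → State d := Torus.periodize (field P)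

/-- The torus field is smooth. [folklore] -/
theorem isSmooth_tfield {P : Packet d} (hP : SuppIn (box d) P) : Torus.IsSmooth (tfield P) :=
  isSmooth_periodize_of_box (contDiff_field P) (tsupport_field_subset_box hP)

/-- Values of the torus field. [folklore] -/
theorem tfield_apply {P : Packet d} (hP : SuppIn (box d) P) (x : UnitAddTorus d) :
    tfield P x = field P (Torus.repr x) :=
  Torus.periodize_eq_apply_repr (g := field P) (eq_zero_off_box (tsupport_field_subset_box hP)) x

/-- The torus field is continuous. [folklore] -/
theorem continuous_tfield {P : Packet d} (hP : SuppIn (box d) P) : Continuous (tfield P) :=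
  (isSmooth_tfield hP).continuous

/-- The torus field is admissible-valued. [folklore] -/
theorem isAdm_tfield [Nonempty d] {P : Packet d} (hP : SuppIn (box d) P) (x : UnitAddTorus d) :
    IsAdm (tfield P x) := by
  rw [tfield_apply hP]; exact isAdm_field P _

/-- **The torus field has integral zero.** [folklore] -/
theorem integral_tfield {P : Packet d} (hP : SuppIn (box d) P) : ∫ x, tfield P x = 0 := by
  rw [tfield, integral_periodize_of_box (continuous_field P) (tsupport_field_subset_box hP), integral_field]

/-- **Energy of the torus field**: `∫_{T^d} ‖tfield‖² = ∫_{ℝ^d} ‖field‖²`. [folklore] -/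
theorem integral_sq_tfield {P : Packet d} (hP : SuppIn (box d) P) :
    ∫ x, ‖tfield P x‖ ^ 2 = ∫ y, ‖field P y‖ ^ 2 := by
  have hs : support (fun y => ‖field P y‖ ^ 2) ⊆ support (field P) := fun y hy h0 => hy (by simp [h0])
  have hts : tsupport (fun y => ‖field P y‖ ^ 2) ⊆ box d := (closure_mono hs).trans (tsupport_field_subset_box hP)
  have h := integral_periodize_of_box (g := fun y => ‖field P y‖ ^ 2) ((continuous_field P).norm.pow 2) hts
  rw [← h]
  refine integral_congr_ae (ae_of_all _ fun x => ?_)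
  show ‖tfield P x‖ ^ 2 = Torus.periodize (fun y => ‖field P y‖ ^ 2) x
  rw [tfield_apply hP, Torus.periodize_eq_apply_repr (g := fun y => ‖field P y‖ ^ 2) (eq_zero_off_box hts) x]

/-! ### Coordinates and their derivatives -/

/-- Velocity coordinates of the torus field. [folklore] -/
theorem vel_tfield {P : Packet d} (hP : SuppIn (box d) P) (x : UnitAddTorus d) (i : d) :
    vel (tfield P x) i = Torus.periodize (Packet.velC P i) x := by
  rw [tfield_apply hP, periodize_eq_repr (tsupport_velC_subset hP i), vel_field_apply]

/-- Stress coordinates of the torus field. [folklore] -/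
theorem str_tfield {P : Packet d} (hP : SuppIn (box d) P) (x : UnitAddTorus d) (i j : d) :
    str (tfield P x) i j = Torus.periodize (Packet.strSC P i j) x - if i = j then Torus.periodize (Packet.prC P) x else 0 := by
  rw [tfield_apply hP, periodize_eq_repr (tsupport_strSC_subset hP i j), periodize_eq_repr (tsupport_prC_subset hP),
    str_field_apply]

/-- The velocity field on the torus. [folklore] -/
def tvel (P : Packet d) (x : UnitAddTorus d) : Ed d := vel (tfield P x)

/-- The velocity field on the torus is smooth. [folklore] -/
theorem isSmooth_tvel {P : Packet d} (hP : SuppIn (box d) P) : Torus.IsSmooth (tvel P) := by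
  have : tvel P = (fun w : State d => vel w) ∘ tfield P := rfl
  unfold tvel
  exact (isSmooth_tfield hP).comp_clm (LinearMap.toContinuousLinearMap
    { toFun := fun w : State d => vel w, map_add' := vel_add, map_smul' := vel_smul })

/-- **The velocity field on the torus is divergence free** (pointwise). [cite: ChoffrutSzekelyhidi2014, Lemma 3] -/
theorem isDivFree_tvel {P : Packet d} (hP : SuppIn (box d) P) : Torus.IsDivFree (tvel P) := by
  intro x
  simp only [Torus.divergence]
  have h : ∀ i, (fun y => tvel P y i) = Torus.periodize (Packet.velC P i) := fun i => funext fun y => vel_tfield hP y i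
  simp only [h, partialDeriv_periodize_of_box (Packet.contDiff_velC P _) (tsupport_velC_subset hP _)]
  exact Packet.div_velC P (Torus.repr x)

end Packet

/-! ## The weak subsolution identities on the torus -/

/-- **Weak stationary subsolution on `T^d`, pressure-free form** (Lemma 2 of the paper, for the
test functions that survive): (i) `∫ Σᵢ vᵢ ∂ᵢθ = 0` for every smooth `θ` (weak `div v = 0`);
(ii) `∫ Σᵢⱼ uᵢⱼ ∂ⱼΦᵢ = 0` for every smooth divergence-free `Φ` (weak `div u + ∇q = 0` tested
against divergence-free fields, where `q` drops out). [cite: ChoffrutSzekelyhidi2014, Lemma 2] -/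
def IsTorusSub (w : UnitAddTorus d → State d) : Prop :=
  (∀ θ : UnitAddTorus d → ℝ, Torus.IsSmooth θ → ∫ x, ∑ i, vel (w x) i * Torus.partialDeriv i θ x = 0) ∧
  ∀ Φ : UnitAddTorus d → Ed d, Torus.IsSmooth Φ → Torus.IsDivFree Φ →
    ∫ x, ∑ i, ∑ j, str (w x) i j * Torus.partialDeriv j (fun y => Φ y i) x = 0

/-- The zero field is a weak subsolution. [folklore] -/
theorem isTorusSub_zero : IsTorusSub (fun _ : UnitAddTorus d => (0 : State d)) := by
  constructor <;> intros <;> simp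

namespace Packet

/-- **(i) for periodised packets**: `∫ Σᵢ vᵢ ∂ᵢθ = ∫ ⟪v, ∇θ⟫ = -∫ θ div v = 0`. [cite: ChoffrutSzekelyhidi2014, Lemma 2] -/
theorem integral_vel_partialDeriv {P : Packet d} (hP : SuppIn (box d) P) {θ : UnitAddTorus d → ℝ}
    (hθ : Torus.IsSmooth θ) : ∫ x, ∑ i, vel (tfield P x) i * Torus.partialDeriv i θ x = 0 := by
  have h1 : ∀ x, ∑ i, vel (tfield P x) i * Torus.partialDeriv i θ x = ⟪tvel P x, Torus.gradient θ x⟫_ℝ := by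
    intro x
    rw [real_inner_comm, Torus.inner_gradient_left, Torus.fderiv_apply_eq_sum_partialDeriv (hθ.isContDiff (by simp))]
    simp only [smul_eq_mul, tvel]
  simp_rw [h1]
  rw [Torus.integral_inner_gradient_eq_neg_integral_mul_divergence_holds (isSmooth_tvel hP) hθ]
  simp [isDivFree_tvel hP _]

/-- **(ii) for periodised packets**: `∫ Σᵢⱼ uᵢⱼ ∂ⱼΦᵢ = 0` for smooth divergence-free `Φ`
(`u = S - qδ`, `div S = 0`, `∫ q div Φ = 0`). [cite: ChoffrutSzekelyhidi2014, Lemma 2] -/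
theorem integral_str_partialDeriv {P : Packet d} (hP : SuppIn (box d) P) {Φ : UnitAddTorus d → Ed d}
    (hΦ : Torus.IsSmooth Φ) (hdiv : Torus.IsDivFree Φ) :
    ∫ x, ∑ i, ∑ j, str (tfield P x) i j * Torus.partialDeriv j (fun y => Φ y i) x = 0 := by
  -- smoothness bookkeeping
  have hS : ∀ i j, Torus.IsSmooth (Torus.periodize (Packet.strSC P i j)) := fun i j =>
    isSmooth_periodize_of_box (Packet.contDiff_strSC P i j) (tsupport_strSC_subset hP i j)
  have hq : Torus.IsSmooth (Torus.periodize (Packet.prC P)) := isSmooth_periodize_of_box (Packet.contDiff_prC P) (tsupport_prC_subset hP)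
  have hΦi : ∀ i, Torus.IsSmooth (fun y => Φ y i) := fun i => hΦ.apply i
  have h1S : ∀ i j, Torus.IsContDiff 1 (Torus.periodize (Packet.strSC P i j)) := fun i j => (hS i j).isContDiff (by simp)
  have h1q : Torus.IsContDiff 1 (Torus.periodize (Packet.prC P)) := hq.isContDiff (by simp)
  have h1Φ : ∀ i, Torus.IsContDiff 1 (fun y => Φ y i) := fun i => (hΦi i).isContDiff (by simp)
  -- rewrite the stress
  have hstr : ∀ x i j, str (tfield P x) i j * Torus.partialDeriv j (fun y => Φ y i) x =
      Torus.periodize (Packet.strSC P i j) x * Torus.partialDeriv j (fun y => Φ y i) x -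
        (if i = j then Torus.periodize (Packet.prC P) x * Torus.partialDeriv j (fun y => Φ y i) x else 0) := by
    intro x i j; rw [str_tfield hP]; split_ifs <;> ring
  simp_rw [hstr, Finset.sum_sub_distrib]
  -- (a) the `S` part: `Σⱼ ∫ S_ij ∂ⱼΦᵢ = -∫ (Σⱼ ∂ⱼ S_ij) Φᵢ = 0`
  have hprod : ∀ i j x, Torus.partialDeriv j (fun y => Torus.periodize (Packet.strSC P i j) y * Φ y i) x =
      Torus.periodize (Packet.strSC P i j) x * Torus.partialDeriv j (fun y => Φ y i) x +
        Torus.partialDeriv j (Torus.periodize (Packet.strSC P i j)) x * Φ x i := fun i j x => Torus.partialDeriv_mul (h1S i j) (h1Φ i) j x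
  have hintS : ∀ i j, Integrable fun x => Torus.periodize (Packet.strSC P i j) x * Torus.partialDeriv j (fun y => Φ y i) x :=
    fun i j => (isSmooth_mul' (hS i j) ((hΦi i).partialDeriv j)).integrable
  have hintS' : ∀ i j, Integrable fun x => Torus.partialDeriv j (Torus.periodize (Packet.strSC P i j)) x * Φ x i :=
    fun i j => (isSmooth_mul' ((hS i j).partialDeriv j) (hΦi i)).integrable
  have hA : ∀ i, ∑ j, ∫ x, Torus.periodize (Packet.strSC P i j) x * Torus.partialDeriv j (fun y => Φ y i) x = 0 := by
    intro i
    have hibp : ∀ j, ∫ x, Torus.periodize (Packet.strSC P i j) x * Torus.partialDeriv j (fun y => Φ y i) x =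
        -∫ x, Torus.partialDeriv j (Torus.periodize (Packet.strSC P i j)) x * Φ x i := by
      intro j
      have h0 := Torus.integral_partialDeriv_eq_zero_holds (F := ℝ) (isSmooth_mul' (hS i j) (hΦi i)) j
      simp_rw [hprod i j] at h0
      rw [integral_add (hintS i j) (hintS' i j)] at h0
      linarith
    simp_rw [hibp]
    rw [Finset.sum_neg_distrib, ← integral_finsetSum _ fun j _ => hintS' i j, neg_eq_zero]
    -- `Σⱼ ∂ⱼ S_ij = 0` pointwise
    have hpt : ∀ x, ∑ j, Torus.partialDeriv j (Torus.periodize (Packet.strSC P i j)) x = 0 := by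
      intro x
      simp only [partialDeriv_periodize_of_box (Packet.contDiff_strSC P i _) (tsupport_strSC_subset hP i _)]
      exact Packet.div_strSC P i (Torus.repr x)
    have hfun : (fun x => ∑ j, Torus.partialDeriv j (Torus.periodize (Packet.strSC P i j)) x * Φ x i) = fun _ => 0 :=
      funext fun x => by rw [← Finset.sum_mul, hpt x, zero_mul]
    rw [hfun, integral_zero]
  -- (b) the pressure part: `Σᵢ ∫ q ∂ᵢΦᵢ = ∫ q div Φ = 0`
  have hint : ∀ i j, Integrable fun x => Torus.periodize (Packet.prC P) x * Torus.partialDeriv j (fun y => Φ y i) x :=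
    fun i j => (isSmooth_mul' hq ((hΦi i).partialDeriv j)).integrable
  have hite : ∀ i j, ∫ x, (if i = j then Torus.periodize (Packet.prC P) x * Torus.partialDeriv j (fun y => Φ y i) x else 0) =
      if i = j then ∫ x, Torus.periodize (Packet.prC P) x * Torus.partialDeriv j (fun y => Φ y i) x else 0 := by
    intro i j; split_ifs <;> simp
  have hB : ∑ i, ∑ j, ∫ x, (if i = j then Torus.periodize (Packet.prC P) x * Torus.partialDeriv j (fun y => Φ y i) x else 0) = 0 := by
    simp_rw [hite, Finset.sum_ite_eq, Finset.mem_univ, if_true]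
    rw [← integral_finsetSum _ fun i _ => hint i i]
    have hfun : (fun x => ∑ i, Torus.periodize (Packet.prC P) x * Torus.partialDeriv i (fun y => Φ y i) x) = fun _ => 0 := by
      funext x
      rw [← Finset.mul_sum]
      have := hdiv x
      rw [Torus.divergence] at this
      rw [this, mul_zero]
    rw [hfun, integral_zero]
  -- assembly
  have hint1 : ∀ i, Integrable fun x => ∑ j, Torus.periodize (Packet.strSC P i j) x * Torus.partialDeriv j (fun y => Φ y i) x :=
    fun i => integrable_finsetSum _ fun j _ => hintS i j
  have hinti : ∀ i j, Integrable fun x =>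
      (if i = j then Torus.periodize (Packet.prC P) x * Torus.partialDeriv j (fun y => Φ y i) x else 0) := by
    intro i j
    split_ifs
    · exact hint i j
    · exact integrable_zero _ _ _
  have hint2 : ∀ i, Integrable fun x =>
      ∑ j, (if i = j then Torus.periodize (Packet.prC P) x * Torus.partialDeriv j (fun y => Φ y i) x else 0) :=
    fun i => integrable_finsetSum _ fun j _ => hinti i j
  have hIA : Integrable fun x => ∑ i, ∑ j, Torus.periodize (Packet.strSC P i j) x * Torus.partialDeriv j (fun y => Φ y i) x :=
    integrable_finsetSum _ fun i _ => hint1 i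
  have hIB : Integrable fun x => ∑ i, ∑ j,
      (if i = j then Torus.periodize (Packet.prC P) x * Torus.partialDeriv j (fun y => Φ y i) x else 0) :=
    integrable_finsetSum _ fun i _ => hint2 i
  rw [integral_sub hIA hIB, integral_finsetSum _ fun i _ => hint1 i, integral_finsetSum _ fun i _ => hint2 i]
  simp_rw [integral_finsetSum _ fun j _ => hintS _ j, integral_finsetSum _ fun j _ => hinti _ j]
  rw [hB, sub_zero]
  exact Finset.sum_eq_zero fun i _ => hA i

/-- **Periodised packets are weak subsolutions on the torus.** [cite: ChoffrutSzekelyhidi2014, Lemma 2, §2 Step 3] -/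
theorem isTorusSub_tfield {P : Packet d} (hP : SuppIn (box d) P) : IsTorusSub (tfield P) :=
  ⟨fun _ hθ => integral_vel_partialDeriv hP hθ, fun _ hΦ hdiv => integral_str_partialDeriv hP hΦ hdiv⟩

end Packet

end StationaryEuler

end Literature.Analysis.FluidPDE
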